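import Summits.BirchSwinnertonDyer.Rank1Residual.Iwasawa.SelmerCardMulKerGDvdConstantCoeff
import Literature.NumberTheory.EllipticCurves.Delbourgo1998.RankZeroLeadingTerm
import HarnessLib

/-!
# Rank `0` over `ℚ`: `#Ш(E/ℚ)[p^∞] ∣ g(0)` for every `g ∈ char_Λ X(E/ℚ_∞)` — the CONCLUSION SHAPE of
# Delbourgo 1998 Prop. 4 on the `B = 0` rows, from Greenberg's Prop. 4.14 record + control ALONE
# (team n1011, row T-CTL-UP, seat p06 GEN 11, FILE 2 — the ℚ-shaped rank-`0` DROP-IN of FILE 1)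

HONEST FRAMING (cell `b2b-bsdres-*`, team n1011, verbatim): prove what is provable now; shrink each
hard class to its core with data; no claim beyond stated classes. Research route on
CONSTRUCTION-SHAPED X4 / §I N10–N11; TOOL theorems only — no definition, no named fact, nothing
booked, no residual-map mark moved, no class closed. Greenberg's Prop. 4.14 enters ONLY as the
explicit binder `(h414 : Greenberg1999.prop414_noFiniteSubmodule_of_not_dvd_torsionOrder)` (registered
record, already consumed by route G); `Delbourgo1998.prop4_rankZero_pow_dvd_constantCoeff` is NOT
used — its module is imported only so that the drop-in's statement is checked against the SAME
`finprod` expression letter for letter.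

## What

Every rank-`0` UPPER-half END of the additive classes at `p` (`Additive/GordRankZeroChiBranch`,
`X4RankZeroSemistableTwist{Even,Odd}`, `X3RankZeroSemistableTwist*`, `CycLeadingTermDvdConverse`,
`GordCycLeadingTerm`) consumes the size-L named fact `hDel : Delbourgo1998.prop4_rankZero_pow_dvd_constantCoeff`
through ONE line, `obtain ⟨-, hdiv⟩ := hDel W p hp2 hadd hGM hr hfin hE κ γ hκ hγ D`, i.e. through its
conclusion at the pair:
`D.IsTorsion ∧ ∀ g ∈ D.charIdeal, p ^ (ord_p #Ш(E)[p^∞] + ord_p ∏ᶠ_{v ∤ p} c_v) ∣ g(0) · #E(ℚ)²`.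
FILE 1 (`Iwasawa/SelmerCardMulKerGDvdConstantCoeff`) proved the UPPER half of control
`#Sel_{p^∞}(E/ℚ) · #ker g_0 ∣ f(0)` from the Prop. 4.14 record + control, with NO local input and NO
reduction hypothesis at `p` beyond the FINITENESS of the level-`0` local tower kernel above `p`. This
file packages it in EXACTLY Delbourgo's conclusion shape on the rows with `p ∤ ∏ᶠ_{v ∤ p} c_v`
(`B = 0`: no Tamagawa number away from `p` divisible by `p` — r2's E3-BUDGET: all but 906 of the
107 677 X4 pot-ordinary rank-`0` pairs), where the Tamagawa exponent is `0`:

* `isTorsion_and_pow_dvd_constantCoeff_mul_sq_of_prop414` — `h414`, `p ∤ #E(ℚ)_tors`, `Finite Ш`,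
  `Finite E(ℚ)`, a finite place set `S ⊇ {p} ∪ {bad}` with the kernels FINITE above `p` for every
  cyclotomic `κ` (`hSp`), `hgood`, and `hB : ¬ p ∣ ∏ᶠ_{v ∤ p} c_v` ⟹ for every cyclotomic `κ`, `γ`,
  `D`: **`D.IsTorsion ∧ ∀ g ∈ D.charIdeal, p ^ (ord_p #Ш[p^∞] + ord_p ∏ᶠ_{v∤p} c_v) ∣ g(0) · #E(ℚ)²`**
  — binder diff against `hDel W p …`: REMOVED {`p ≠ 2`, additive at `p`, (G)-ordinary-or-`ord_p j < 0`,
  `r_an = 0`}, ADDED {`h414`, `htors`, `S / hSp / hgood`, `hB`};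
* `natCard_primaryComponent_sha_dvd_constantCoeff_of_prop414'` (place-set form of FILE 1 §4 with the
  cyclotomic socket family) and `padicValNat_shaOrder_le_valuation_constantCoeff_of_prop414` —
  **`ord_p #Ш(E/ℚ) ≤ v_p(g(0))`** in `ℚ_p` for `g(0) ≠ 0` (the inequality the assemblies read off `hdiv`).

Sockets above `p` (FINITENESS only) are theorems of the tree class-wide: `= ⊥` on X4♯(G-ord) ∩ `I₀*`
(p12 T-T3B F7 `GoodModelLine.ClassX4Gord.localTowerKerPrimary_zero_eq_bot`), on X4(M)/X3♯(M) mod A41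
(T-T3M), finite at good ordinary `p` (`finite_localTowerKerPrimary_zero_of_ordinary`). NOT claimed:
the Tamagawa exponent on `B ≥ 1` rows (`#ker g_0 ≥ ∏ c_v^{(p)}` is global duality); the re-key of the
owners' ENDs (offered, their call). Axioms standard.

References: [GreenbergLNM1716] §4 Thm. 4.1 (pp. 102–104), Prop. 4.14 (§4), proof of Prop. 4.8;
[Delbourgo1998] Prop. 4 (p. 144) — shape only; [HachimoriMatsuno2000] Cor. (i);
cells/n1011/skel/T-CTL-UP.md.
-/

noncomputable section

open scoped Classical NumberField

open WeierstrassCurve NumberField Literature.NumberTheory.EllipticCurves IsDedekindDomain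
  Summit.BirchSwinnertonDyer.Rank1Residual.Iwasawa

namespace Summit.BirchSwinnertonDyer.Rank1Residual.Additive

variable (W : WeierstrassCurve ℚ) [W.IsElliptic] [W.IsGloballyMinimal] (p : ℕ) [hp : Fact p.Prime]

/-- **`#Ш(E/ℚ)[p^∞] ∣ g(0)` for every `g ∈ char_Λ X(E/ℚ_∞)`, place-set form with the CYCLOTOMIC
socket family** (`hSp` quantified over the cyclotomic `κ`, as the class-wide socket theorems are
stated): FILE 1's `natCard_primaryComponent_sha_dvd_constantCoeff_of_prop414` at a cyclotomic `κ`.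
Rank `0` (`E(ℚ)` finite), `p ∤ #E(ℚ)_tors`, `W` globally minimal.
[cite: GreenbergLNM1716, §4 Thm. 4.1 (proof, pp. 102–104) and Prop. 4.14] -/
theorem natCard_primaryComponent_sha_dvd_constantCoeff_of_prop414' [Finite W.toAffine.Point]
    [Finite (AddCommGroup.primaryComponent W.sha p)]
    (h414 : Greenberg1999.prop414_noFiniteSubmodule_of_not_dvd_torsionOrder)
    (htors : ¬ p ∣ W.torsionOrder) (S : Finset (HeightOneSpectrum (𝓞 ℚ)))
    (hSp : ∀ κ : ZpExtension ℚ p, κ.IsCyclotomic → ∀ v ∈ S, (p : 𝓞 ℚ) ∈ v.asIdeal →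
      Finite (W.localTowerKerPrimary κ (v.adicCompletion ℚ) 0))
    (hgood : ∀ v ∉ S, (p : 𝓞 ℚ) ∉ v.asIdeal ∧ W.HasGoodReductionAt v)
    {κ : ZpExtension ℚ p} {γ : Field.absoluteGaloisGroup ℚ} (hκ : κ.IsCyclotomic)
    (hγ : κ.IsTopGenerator γ) (D : W.SelmerDualData κ γ) {g : IwasawaAlgebra p} (hg : g ∈ D.charIdeal) :
    (Nat.card (AddCommGroup.primaryComponent W.sha p) : ℤ_[p]) ∣ PowerSeries.constantCoeff g :=
  natCard_primaryComponent_sha_dvd_constantCoeff_of_prop414 W h414 htors hκ hγ D S (hSp κ hκ) hgood hg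

/-- **THE DROP-IN: Delbourgo 1998 Prop. 4's CONCLUSION SHAPE on the `B = 0` rows, from Greenberg's
Prop. 4.14 record + control.** Let `W/ℚ` be globally minimal elliptic, `p` a prime with
`p ∤ #E(ℚ)_tors`, `Ш(E/ℚ)` and `E(ℚ)` finite (rank `0`); let `S` be a finite set of places off which
every place is prime to `p` and good, such that for every CYCLOTOMIC `ℤ_p`-extension the level-`0`
local tower kernel has finite `p`-power torsion at the places of `S` above `p`; assume
`p ∤ ∏ᶠ_{v ∤ p} c_v` (`B = 0`). Then for every cyclotomic `κ`, topological generator `γ` and dual datum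
`D`: `X(E/ℚ_∞)` is `Λ`-torsion and, for every `g ∈ char_Λ X`,
`p ^ (ord_p #Ш(E)[p^∞] + ord_p ∏ᶠ_{v ∤ p} c_v) ∣ g(0) · #E(ℚ)²` in `ℤ_p` — token-for-token the
conclusion of `Delbourgo1998.prop4_rankZero_pow_dvd_constantCoeff W p …`, so that an END consuming
`hDel` by `obtain ⟨-, hdiv⟩ := hDel W p hp2 hadd hGM hr hfin hE κ γ hκ hγ D` can consume this theorem
instead (binders: `h414 htors S hSp hgood hB hfin hE κ γ hκ hγ D`). Mechanism: `ord_p ∏ᶠ = 0` (`hB`),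
`p ^ ord_p #Ш[p^∞] ∣ #Ш[p^∞] ∣ g(0)` (FILE 1), times `#E(ℚ)²`. NO hypothesis on the reduction at `p`
(additive or not), no `p ≠ 2`, no analytic rank.
[cite: GreenbergLNM1716, §4 Thm. 4.1 (proof, pp. 102–104) and Prop. 4.14]
[cite: Delbourgo1998, Prop. 4 (p. 144) (shape only; not used)] -/
theorem isTorsion_and_pow_dvd_constantCoeff_mul_sq_of_prop414
    (h414 : Greenberg1999.prop414_noFiniteSubmodule_of_not_dvd_torsionOrder)
    (htors : ¬ p ∣ W.torsionOrder) (S : Finset (HeightOneSpectrum (𝓞 ℚ)))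
    (hSp : ∀ κ : ZpExtension ℚ p, κ.IsCyclotomic → ∀ v ∈ S, (p : 𝓞 ℚ) ∈ v.asIdeal →
      Finite (W.localTowerKerPrimary κ (v.adicCompletion ℚ) 0))
    (hgood : ∀ v ∉ S, (p : 𝓞 ℚ) ∉ v.asIdeal ∧ W.HasGoodReductionAt v)
    (hB : ¬ p ∣ ∏ᶠ v : HeightOneSpectrum (𝓞 ℚ),
      (if (p : 𝓞 ℚ) ∈ v.asIdeal then 1 else W.tamagawaNumberAt v))
    (hfin : Finite W.sha) (hE : Finite W.toAffine.Point)
    (κ : ZpExtension ℚ p) (γ : Field.absoluteGaloisGroup ℚ) (hκ : κ.IsCyclotomic)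
    (hγ : κ.IsTopGenerator γ) (D : W.SelmerDualData κ γ) :
    D.IsTorsion ∧
      ∀ g ∈ D.charIdeal,
        (p : ℤ_[p]) ^ (padicValNat p (Nat.card (AddCommGroup.primaryComponent W.sha p)) +
            padicValNat p (∏ᶠ v : HeightOneSpectrum (𝓞 ℚ),
              if (p : 𝓞 ℚ) ∈ v.asIdeal then 1 else W.tamagawaNumberAt v)) ∣
          PowerSeries.constantCoeff g * ((Nat.card W.toAffine.Point : ℕ) : ℤ_[p]) ^ 2 := by
  haveI := hfin
  haveI := hE
  haveI hfinp : Finite (AddCommGroup.primaryComponent W.sha p) := inferInstance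
  have hSel : Finite (W.selmerGroupPInfty p) := W.finite_selmerGroupPInfty_of_finite_primaryComponent p
  have hK := forall_smul_eq_zero_imp_of_not_dvd_torsionOrder W (p := p) htors
  -- a generator of the (principal) characteristic ideal, and torsion by control
  haveI : (Module.charIdeal (IwasawaAlgebra p) D.X).IsPrincipal := charIdeal_isPrincipal_holds p D.X
  obtain ⟨f, hchar⟩ := Submodule.IsPrincipal.principal (Module.charIdeal (IwasawaAlgebra p) D.X)
  have hf : D.charIdeal = Ideal.span {f} := hchar
  obtain ⟨hgfin, -⟩ := natCard_selmer_mul_natCard_kerG_dvd_constantCoeff_of_prop414 W h414 htors hκ hγ D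
    hSel f hf S (hSp κ hκ) hgood
  obtain ⟨-, hX, -⟩ := constantCoeff_eq_unit_mul_natCard_selmer_mul_natCard_kerG_of_no_pTorsion W D hγ
    hSel hgfin hK (forall_finite_eq_bot_of_prop414 W h414 htors hκ hγ D) f hf
  refine ⟨hX, fun g hg ↦ ?_⟩
  -- `ord_p ∏ᶠ_{v ∤ p} c_v = 0` on a `B = 0` row
  rw [padicValNat.eq_zero_of_not_dvd hB, add_zero]
  -- `p ^ ord_p #Ш[p^∞] ∣ #Ш[p^∞] ∣ g(0) ∣ g(0) · #E(ℚ)²`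
  have h1 : ((p : ℕ) : ℤ_[p]) ^ padicValNat p (Nat.card (AddCommGroup.primaryComponent W.sha p)) ∣
      (Nat.card (AddCommGroup.primaryComponent W.sha p) : ℤ_[p]) := by
    have h := Nat.cast_dvd_cast (α := ℤ_[p])
      (pow_padicValNat_dvd (p := p) (n := Nat.card (AddCommGroup.primaryComponent W.sha p)))
    rwa [Nat.cast_pow] at h
  exact (h1.trans (natCard_primaryComponent_sha_dvd_constantCoeff_of_prop414' W p h414 htors S hSp
    hgood hκ hγ D hg)).mul_right _

/-- **`ord_p #Ш(E/ℚ) ≤ v_p(g(0))`** for every `g ∈ char_Λ X(E/ℚ_∞)` with `g(0) ≠ 0` — the valuation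
reading of `#Ш[p^∞] ∣ g(0)` (rank `0`: `E(ℚ)` and `Ш` finite, `ord_p #Ш[p^∞] = ord_p #Ш`), modulo the
Prop. 4.14 record; hypotheses as in the drop-in (no `hB` needed). This is the inequality the rank-`0`
upper-half assemblies extract from `hDel`, WITHOUT its Tamagawa term.
[cite: GreenbergLNM1716, §4 Thm. 4.1 (proof, pp. 102–104) and Prop. 4.14] -/
theorem padicValNat_shaOrder_le_valuation_constantCoeff_of_prop414
    (h414 : Greenberg1999.prop414_noFiniteSubmodule_of_not_dvd_torsionOrder)
    (htors : ¬ p ∣ W.torsionOrder) (S : Finset (HeightOneSpectrum (𝓞 ℚ)))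
    (hSp : ∀ κ : ZpExtension ℚ p, κ.IsCyclotomic → ∀ v ∈ S, (p : 𝓞 ℚ) ∈ v.asIdeal →
      Finite (W.localTowerKerPrimary κ (v.adicCompletion ℚ) 0))
    (hgood : ∀ v ∉ S, (p : 𝓞 ℚ) ∉ v.asIdeal ∧ W.HasGoodReductionAt v)
    (hfin : Finite W.sha) (hE : Finite W.toAffine.Point)
    {κ : ZpExtension ℚ p} {γ : Field.absoluteGaloisGroup ℚ} (hκ : κ.IsCyclotomic)
    (hγ : κ.IsTopGenerator γ) (D : W.SelmerDualData κ γ) {g : IwasawaAlgebra p} (hg : g ∈ D.charIdeal)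
    (hg0 : PowerSeries.constantCoeff g ≠ 0) :
    (padicValNat p W.shaOrder : ℤ) ≤ ((PowerSeries.constantCoeff g : ℤ_[p]) : ℚ_[p]).valuation := by
  haveI := hfin
  haveI := hE
  haveI hfinp : Finite (AddCommGroup.primaryComponent W.sha p) := inferInstance
  obtain ⟨c, hc⟩ := natCard_primaryComponent_sha_dvd_constantCoeff_of_prop414' W p h414 htors S hSp hgood
    hκ hγ D hg
  set N : ℚ_[p] := ((Nat.card (AddCommGroup.primaryComponent W.sha p) : ℤ_[p]) : ℚ_[p]) with hN_def
  set cQ : ℚ_[p] := ((c : ℤ_[p]) : ℚ_[p]) with hcQ_def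
  have hNpos : 0 < Nat.card (AddCommGroup.primaryComponent W.sha p) := Nat.card_pos
  have hN0 : N ≠ 0 := by
    rw [hN_def, PadicInt.coe_natCast]; exact_mod_cast hNpos.ne'
  have hg0Q : ((PowerSeries.constantCoeff g : ℤ_[p]) : ℚ_[p]) ≠ 0 := fun h ↦
    hg0 (PadicInt.coe_eq_zero.mp h)
  have hprod : ((PowerSeries.constantCoeff g : ℤ_[p]) : ℚ_[p]) = N * cQ := by
    rw [hN_def, hcQ_def, ← PadicInt.coe_mul, ← hc]
  have hc0 : cQ ≠ 0 := fun h ↦ hg0Q (by rw [hprod, h, mul_zero])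
  have hNval : N.valuation = (padicValNat p W.shaOrder : ℤ) := by
    rw [hN_def, PadicInt.coe_natCast, Padic.valuation_natCast, padicValNat_card_addPrimaryComponent,
      WeierstrassCurve.shaOrder]
  have hcnn : 0 ≤ cQ.valuation := PadicInt.valuation_coe_nonneg
  rw [hprod, Padic.valuation_mul hN0 hc0, hNval]
  linarith

end Summit.BirchSwinnertonDyer.Rank1Residual.Additive

end
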